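import Literature.ModelTheory.PseudofiniteFields.DefinableProjection

/-!
# Stub H7 of line LonelyTranslates (c1): definability of coordinate projections

Crux `PairwiseCurvedTilingsLC` (route DefinableSTPPDichotomy, stmt-MatrixMultiplication-17883),
negative line LonelyTranslates, continuation c1 ("Prop27Reduction").  The registered stub
`stub_definable_projection`: the image of a definable set `X ⊆ K^m` (presented as
`{x | φ.Realize (Sum.elim x y)}`, a ring formula `φ` with parameters `y` from `K`) under the
coordinate projection `K^m → K^n` given by a splitting `τ : Fin m ≃ Fin n ⊕ Fin p` (the `Fin p`
block forgotten) is again of this shape.  It is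
`Literature.ModelTheory.PseudofiniteFields.definableSet_exists_block` (relabel + a block of
existential quantifiers) and is consumed by Case 2 of the chart induction (`stub_openPiece`) of
the skeleton.
-/

set_option linter.dupNamespace false  -- `Summit.<S>.<S>.…` is the mandated namespace

namespace Summit.MatrixMultiplication.MatrixMultiplication.Theorems.PairwiseCurvedTilingsLC.Negative

open FirstOrder FirstOrder.Language FirstOrder.Ring
open Literature.ModelTheory.PseudofiniteFields

/-- STUB (helper H7, definability of coordinate projections): the image of a definable set under
a coordinate projection `K^m → K^n` (coordinates split by `τ : Fin m ≃ Fin n ⊕ Fin p`, the `Fin p`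
block forgotten) is definable (`definableSet_exists_block`). -/
theorem stub_definable_projection (K : Type) [Field K] [CompatibleRing K] {m n p : ℕ}
    (τ : Fin m ≃ Fin n ⊕ Fin p) (X : Set (Fin m → K))
    (hX : ∃ (n' : ℕ) (φ : Language.ring.Formula (Fin m ⊕ Fin n')) (y : Fin n' → K),
      X = {x | φ.Realize (Sum.elim x y)}) :
    ∃ (n' : ℕ) (φ : Language.ring.Formula (Fin n ⊕ Fin n')) (y : Fin n' → K),
      {v : Fin n → K | ∃ w : Fin p → K, (fun i => Sum.elim v w (τ i)) ∈ X} =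
        {x | φ.Realize (Sum.elim x y)} :=
  definableSet_exists_block τ hX

end Summit.MatrixMultiplication.MatrixMultiplication.Theorems.PairwiseCurvedTilingsLC.Negative
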